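import Summits.ABC.IUTFork.Joshi.TestHarness
import HarnessLib

/-!
# Branch E TEST HARNESS, II (adversary seat abc-iut-E-cx): the SEPARATION MODEL — every volume shape and indeterminacy
# CONTAINMENT hold, the printed Statement holds, S fails

AUTHORED BY abc-iut-E-cx (refuter seat refuter-abc-iut-E-cx-g0-0); proxy-filed VERBATIM by a prover hand per the cell's PROXY RULE
(plan/repair/REPAIR-SPEC.md §2). Companion of `Joshi/TestHarness.lean` (plan/E/cx/TEST-LEDGER.md §1 row «separation model», §4 row H5). **No side is taken** on
[IUTchIII] Cor. 3.12, on Joshi's claims (unrefereed preprints) or on Mochizuki's report on them; typed ≠ proved ≠ endorsed.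
PROOF-ONLY over the frozen vocabulary plus ONE toy datum (the exponent vector `e = (2,4)` of abc-iut-w5-d232's family
`NaiveWitness.expSetting p e`, Cor312PinnedGapNotNecessary p420276 / …Hull p420658); no `Prop` fact, no instance.

RESULT `volumeShapes_and_not_pilotKummerIndRelated`: at `expSetting 2 (2,4)` over abc-iut-w5-d247's contentful naive situation the
typed Theorem 3.11 (i)–(iii), every bridge hypothesis, `|log(q)| > 0`, all three pins, `Cor312Vol.VolumeTransport`,
`Joshi.SubsetVolumeBound`, `Joshi.HullVolumeDominance`, `Joshi.IndCoversQ` (with the IDENTITY indeterminacy: `B_{e_j} ⊆ B_{j²}` as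
`(2,4) ≥ (1,4)`) AND the printed Statement (`2 + 4 ≥ 5`) all HOLD, while S := `PilotKummerIndRelated` FAILS (S ⟺ `e = (1,4)`,
w5-d232's `expSetting_reading3_iff'` + w5-d230's `reading3_iff_pilotKummerIndRelated`). Hence NO volume shape — and not even
containment up to indeterminacy — implies S: a typed Joshi object landing in such a shape BYPASSES S (TEST-LEDGER value «S-BYPASSED»;
for a volume-shaped J the value «COUNTERMODEL at the pinned countermodel» is unavailable by `Joshi/TestHarness.lean` §4).
Interface/toy level (one place, `l⋇ = 2`, formal ball volumes); no judgement on print or preprint.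
[claim: Mochizuki2012, status: disputed] [cite: ScholzeStix2018, §2.2 pp. 9–10]. Standard axioms only; no `sorry`.
-/

noncomputable section

open Set

namespace Summit.ABC.IUTFork.Joshi

open Thm311 Cor312 Cor312Vol Cor312.Checks Cor312.IdentifiedNonVacuity Literature.IUT.LogThetaLattice

/-! ## The separation model `e = (2,4)` -/

section Separation

open PinnedWitness NaiveWitness GluedMonoids.Naive

variable (p : ℕ) [hp : Fact p.Prime]

/-- The exponent vector `e = (2, 4)` of abc-iut-w5-d232's family `{(±q^{e_j})_j}` (`l⋇ = 2`). [folklore] -/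
def expTwoFour : toyIndex.LabelStar → ℕ := fun j => if j.1 = 1 then 2 else 4

/-- `e₁ + e₂ = 6`. [folklore] -/
theorem esum_expTwoFour : esum expTwoFour = 6 := by decide

/-- `e_j ≥ j²` at both labels: `(2,4) ≥ (1,4)`. [folklore] -/
theorem jsq_le_expTwoFour {j : toyIndex.Label} (hj : j ≠ 0) : jsq j ≤ (expTwoFour ⟨j, hj⟩ : ℤ) := by
  rcases labelStar_cases ⟨j, hj⟩ with h | h
  · have h1 : j = 1 := congrArg Subtype.val h
    subst h1
    show jsq 1 ≤ ((2 : ℕ) : ℤ)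
    decide
  · have h2 : j = 2 := congrArg Subtype.val h
    subst h2
    show jsq 2 ≤ ((4 : ℕ) : ℤ)
    decide

omit hp in
/-- The q-region `B_{e_j}` lies inside the Θ-region `B_{j²}` at every label of `e = (2,4)`. [folklore] -/
theorem qBall_subset_thetaBall_expTwoFour [Fact p.Prime] (j : toyIndex.Label) (vQ : toyIndex.VQ) :
    pBall p j vQ (expAt expTwoFour j) ⊆ pBall p j vQ (jsq j) := by
  by_cases hj : j = 0
  · subst hj
    exact Subset.rfl
  · rw [expAt_of_ne_zero _ hj]
    exact (pBall_subset_iff p j vQ _ _).2 (jsq_le_expTwoFour hj)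

/-- **VT HOLDS at `e = (2,4)`** (m = 0: `−e_j·log p ≤ −j²·log p`). [folklore] -/
theorem volumeTransport_expTwoFour : VolumeTransport (expSetting p expTwoFour) := by
  intro i vQ
  refine ⟨0, ?_⟩
  rw [expSetting_qLocal_labelSucc]
  show _ ≤ pVol p _ vQ (pBall p _ vQ (jsq _))
  rw [pVol_pBall]
  have hL := log_p_pos p
  have hle : ((jsq (Setting.labelSucc i : toyIndex.Label) : ℤ) : ℝ) ≤
      ((expTwoFour ⟨Setting.labelSucc i, Setting.labelSucc_ne_zero i⟩ : ℕ) : ℝ) := by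
    exact_mod_cast jsq_le_expTwoFour (Setting.labelSucc_ne_zero i)
  nlinarith

/-- Admissibility of the Kummer images at every `expSetting` (they are balls). [folklore] -/
theorem thetaRegionsAdm_expSetting (e : toyIndex.LabelStar → ℕ) : ThetaRegionsAdm (expSetting p e) :=
  fun _ _ _ => ⟨jsq _, rfl⟩

/-- SVB and HVD HOLD at `e = (2,4)`. [folklore] -/
theorem subsetVolumeBound_expTwoFour : SubsetVolumeBound (expSetting p expTwoFour) :=
  subsetVolumeBound_of_volumeTransport (thetaRegionsAdm_expSetting p _) (volumeTransport_expTwoFour p)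

/-- The typed Statement HOLDS at `e = (2,4)` (`6 ≥ 5`). [folklore] -/
theorem statement_expTwoFour : (expSetting p expTwoFour).Statement :=
  (expSetting_statement_iff p _).2 (by decide)

/-- `|log(q)| > 0` at `e = (2,4)`. [folklore] -/
theorem absLogQPos_expTwoFour : (expSetting p expTwoFour).AbsLogQPos := expSetting_absLogQPos p _ (by decide)

/-- **S FAILS at `e = (2,4)`** (S ⟺ Reading R3 under the pins and Thm 3.11 (ii)(b); R3 ⟺ `e = (1,4)`). [folklore] -/
theorem not_pilotKummerIndRelated_expTwoFour :
    ¬ PilotKummerIndRelated (naiveFull p).toLatticeSituation (expSetting p expTwoFour) (ballOfMonoid p)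
      fun v _ => qDatumExp p expTwoFour v := fun h => by
  have h3 := (reading3_iff_pilotKummerIndRelated (naiveFull p).toLatticeSituation (expSetting p expTwoFour)
    (ballOfMonoid p) (fun v _ => qDatumExp p expTwoFour v) ((naive_partII p (expSetting p expTwoFour).n).2.1)
    (expSetting_pinnedRegions p _)).2 h
  have h14 := (expSetting_reading3_iff' p expTwoFour).1 h3
  exact absurd h14.1 (by decide)

/-- **`IndCoversQ` HOLDS at `e = (2,4)` — with the IDENTITY indeterminacy** (`B_{e_j} ⊆ B_{j²}` since `e_j ≥ j²`): containment up to
indeterminacy is too weak to force S. [folklore] -/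
theorem indCoversQ_expTwoFour :
    IndCoversQ (naiveFull p).toLatticeSituation (expSetting p expTwoFour) (ballOfMonoid p)
      fun v _ => qDatumExp p expTwoFour v := by
  intro j vQ
  refine ⟨1, Subgroup.one_mem _, 0, ?_⟩
  rw [← (expSetting_pinnedRegions p expTwoFour).1.2 0 j vQ, ballOfMonoid_qDatumExp]
  show pBall p j vQ (expAt expTwoFour j) ⊆ (fun x => x) '' (expSetting p expTwoFour).thetaRegion 0 j vQ
  rw [image_id']
  exact qBall_subset_thetaBall_expTwoFour p j vQ

/-- **SEPARATION, packaged — `volumeShapes_and_not_pilotKummerIndRelated`.** There is an instantiation (w5-d232's `expSetting 2 (2,4)`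
over abc-iut-w5-d247's contentful naive situation) where the typed Theorem 3.11 (i)–(iii), every bridge hypothesis, `|log(q)| > 0`,
all three pins, VT, SVB, HVD, `IndCoversQ` AND the printed Statement HOLD, while S FAILS. Hence no volume shape, and not even
indeterminacy-containment, implies S; a typed Joshi object of such a shape BYPASSES S (TEST-LEDGER value «S-BYPASSED»). Interface/toy
level; no judgement on print or preprint. [folklore] -/
theorem volumeShapes_and_not_pilotKummerIndRelated :
    ∃ (T : ThetaIndex) (F : FullSituation T) (P : Cor312.Setting F.toLatticeSituation.toSituation)
      (ρ : (∀ v : T.V, v ∈ T.Vbad → Set (F.L.StarPacket v)) → ∀ (j : T.Label) (vQ : T.VQ), Set (F.L.Packet j vQ))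
      (qK : ∀ v : T.V, v ∈ T.Vbad → Set (F.L.StarPacket v)),
      F.Statement ∧ BridgeHyps P ∧ P.AbsLogQPos ∧ PinnedRegions3 F.toLatticeSituation P ρ qK ∧
        VolumeTransport P ∧ SubsetVolumeBound P ∧ HullVolumeDominance P ∧ IndCoversQ F.toLatticeSituation P ρ qK ∧
        P.Statement ∧ ¬ PilotKummerIndRelated F.toLatticeSituation P ρ qK := by
  haveI : Fact (Nat.Prime 2) := ⟨Nat.prime_two⟩
  exact ⟨toyIndex, naiveFull 2, expSetting 2 expTwoFour, ballOfMonoid 2, fun v _ => qDatumExp 2 expTwoFour v,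
    naiveFull_statement 2, expSetting_bridgeHyps 2 _, absLogQPos_expTwoFour 2, expSetting_pinnedRegions3 2 _,
    volumeTransport_expTwoFour 2, subsetVolumeBound_expTwoFour 2,
    hullVolumeDominance_of_subsetVolumeBound (expSetting_bridgeHyps 2 _) (subsetVolumeBound_expTwoFour 2),
    indCoversQ_expTwoFour 2, statement_expTwoFour 2, not_pilotKummerIndRelated_expTwoFour 2⟩

end Separation

end Summit.ABC.IUTFork.Joshi

end
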